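import Summits.MatrixMultiplication.OmegaCensus.SmallFormats.RankOnePlaneCapEqualityCol
import Summits.MatrixMultiplication.OmegaCensus.SmallFormats.RankOnePlaneCapNear
import HarnessLib

/-!
# ω-census family (a): the near-saturated law and the pinned OUTPUT for COLUMN planes `{z λᵀ}`

Cell `pub-omega` (unit `pub-omega-tensor`, gen 22), topic `Summits/MatrixMultiplication/OmegaCensus`
(sub-folder `SmallFormats`). Framing (verbatim): lottery ticket; floor = certified bounds/negative
ranges. HONEST FRAMING: the mirror images of `RankOnePlaneCapNear` under the transpose-dual symmetry
`(X, Y, Z) ↦ (Xᵀ, Zᵀ, Yᵀ)` (`exists_transposeDual'`), written in terms of the ORIGINAL computation —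
exactly as lit gen 6 did for the equality case in `RankOnePlaneCapEqualityCol`. Used by the cell's
exclusion engines when the COLUMN side of an X-marginal is the better one ("best side": the roles of
the Y-coefficient matrices `G_i` and of the outputs `W_i` are exchanged). Not a rank bound; nothing
on `ω`.

* `card_vanishing_col_quant_near` (`⟨2,m,n⟩`, `m ≥ 2`): `|R| + 6n + 1 = 2r` X-forms vanishing on the
  column plane `{z λᵀ : z ∈ k²}` (`λ ∈ k^m ∖ 0`) ⇒ with `θ ⊥ λ` and `E = span{θᵀG_i : i ∉ R}`:
  `dim E + 2n = |Rᶜ|`, `2·dim E + |R| = 2n + 1`, and every `Y' ∈ k^{2×n}` Frobenius-orthogonal to all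
  outputs `W_i`, `i ∈ R`, has both rows in `E`.
* `x_pairing_of_colForms`: if the X-forms of `R` are `f_i(X) = ξ_iᵀ X η` with a common COLUMN vector
  `η` (`η_{κ'} ≠ 0`) and `θ := η`, `φ ⊥ ηᵀG_i` for `i ∉ R`, then for all `x ∈ k²`, `Y' ∈ k^{2×n}`:
  `xᵀ Y' φ = ∑_{i∈R} (ηᵀG_iφ) (x·ξ_i) ⟨W_i, Y'⟩`.
* `pinned_output` (pattern `{s; d, d, …}` of the ROW factors `ξ_i`): `x₀ ⊥ ξ_i` (`i ∈ R ∖ t₁`),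
  `x₀·ξ_{t₁} = 1` ⇒ `(ηᵀG_{t₁}φ) · W_{t₁} = x₀ φᵀ` — the OUTPUT of `t₁` is the rank-one matrix `x₀φᵀ`
  up to the scalar, which is nonzero when `φ ≠ 0` (`pinned_output_coeff_ne_zero`).
-/

namespace Summit.MatrixMultiplication.OmegaCensus.RankOnePlaneCapGeneral

open Module Matrix Literature.Computability.AlgebraicComplexity

variable {k : Type*} [Field k] {c m n : ℕ} {ι : Type*} [Fintype ι]

/-- `(ξᵀ Xᵀ)·η = (ηᵀ X)·ξ`. -/
theorem vecMul_transpose_dotProduct (ξ : Fin c → k) (X : Matrix (Fin m) (Fin c) k) (η : Fin m → k) :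
    (ξ ᵥ* Xᵀ) ⬝ᵥ η = (η ᵥ* X) ⬝ᵥ ξ := by
  rw [Matrix.vecMul_transpose, dotProduct_comm, Matrix.dotProduct_mulVec]

/-- `⟨W, y wᵀ⟩_F = yᵀ W w`. -/
theorem sum_sum_mul_vecMulVec (W : Matrix (Fin c) (Fin n) k) (y : Fin c → k) (w : Fin n → k) :
    (∑ κ, ∑ ν, W κ ν * vecMulVec y w κ ν) = y ⬝ᵥ (W *ᵥ w) := by
  simp only [vecMulVec_apply, Matrix.mulVec, dotProduct, Finset.mul_sum]
  exact Finset.sum_congr rfl fun κ _ => Finset.sum_congr rfl fun ν _ => by ring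

/-- **Near-saturated law for column planes** (`⟨2,m,n⟩`, `m ≥ 2`): if `|R| + 6n + 1 = 2r` X-forms
vanish on `{z λᵀ : z ∈ k²}` (`λ ∈ k^m ∖ 0`), then with `θ ⊥ λ` and `E = span{θᵀ G_i : i ∉ R}`
(`G_i μ ν = g_i(E_{μν})`): `dim E + 2n = |Rᶜ|`, `2·dim E + |R| = 2n + 1`, and every `Y'`
Frobenius-orthogonal to all outputs `W_i`, `i ∈ R`, has its rows in `E`. -/
theorem card_vanishing_col_quant_near [DecidableEq ι] (hm : 2 ≤ m)
    (β : BilinComp (mulBilin k 2 m n) ι) {lam : Fin m → k} (hlam : lam ≠ 0) (R : Finset ι)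
    (hR : ∀ i ∈ R, ∀ z : Fin 2 → k, β.f i (vecMulVec z lam) = 0)
    (hnear : R.card + 6 * n + 1 = 2 * Fintype.card ι) :
    ∃ (θ : Fin m → k) (E : Submodule k (Fin n → k)),
      θ ≠ 0 ∧ θ ⬝ᵥ lam = 0 ∧
      E = Submodule.span k
        ((fun i => θ ᵥ* Matrix.of fun μ ν => β.g i (Matrix.single μ ν (1 : k))) '' ↑(Finset.univ \ R)) ∧
      finrank k E + 2 * n = (Finset.univ \ R).card ∧
      2 * finrank k E + R.card = 2 * n + 1 ∧
      (∀ Y' : Matrix (Fin 2) (Fin n) k,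
        (∀ i ∈ R, (∑ κ, ∑ ν, β.w i κ ν * Y' κ ν) = 0) → ∀ κ, Y' κ ∈ E) := by
  obtain ⟨β', hf, hg, hw⟩ := exists_transposeDual' β
  have hR' : ∀ i ∈ R, ∀ z : Fin 2 → k, β'.f i (vecMulVec lam z) = 0 := by
    intro i hi z
    rw [hf, Matrix.transpose_vecMulVec]
    exact hR i hi z
  obtain ⟨θ, E, hθ, hθlam, hE, hdim, hdim2, hzero, -⟩ :=
    card_vanishing_quant_near hm β' hlam R hR' hnear
  refine ⟨θ, E, hθ, hθlam, ?_, hdim, hdim2, ?_⟩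
  · rw [hE]
    congr 1
    ext v
    simp only [Set.mem_image, hw]
  · intro Y' hY'
    refine hzero Y' fun i hi => ?_
    rw [hg]
    exact hY' i hi

/-- **Local identity, column form.** If the X-forms of `R` are `f_i(X) = ξ_iᵀ X η` with a common
column vector `η` (`η_{κ'} ≠ 0`) and `φ ⊥ ηᵀG_i` for `i ∉ R` (`G_i μ ν = g_i(E_{μν})`), then for all
`x ∈ k²` and `Y' ∈ k^{2×n}`: `xᵀ Y' φ = ∑_{i∈R} (ηᵀG_iφ) · (x·ξ_i) · ⟨W_i, Y'⟩_F`. -/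
theorem x_pairing_of_colForms (β : BilinComp (mulBilin k 2 m n) ι) {η : Fin m → k} {κ' : Fin m}
    (hκ' : η κ' ≠ 0) (R : Finset ι) (ξ : ι → Fin 2 → k)
    (hf : ∀ i ∈ R, ∀ X : Matrix (Fin 2) (Fin m) k, β.f i X = (ξ i ᵥ* X) ⬝ᵥ η)
    (φ : Fin n → k)
    (hφ : ∀ i, i ∉ R → (η ᵥ* Matrix.of fun μ ν => β.g i (Matrix.single μ ν (1 : k))) ⬝ᵥ φ = 0)
    (x : Fin 2 → k) (Y' : Matrix (Fin 2) (Fin n) k) :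
    x ⬝ᵥ (Y' *ᵥ φ) = ∑ i ∈ R, ((η ᵥ* Matrix.of fun μ ν => β.g i (Matrix.single μ ν (1 : k))) ⬝ᵥ φ)
      * (x ⬝ᵥ ξ i) * (∑ κ, ∑ ν, β.w i κ ν * Y' κ ν) := by
  obtain ⟨β', hf', hg, hw⟩ := exists_transposeDual' β
  have hfβ' : ∀ i ∈ R, ∀ X' : Matrix (Fin m) (Fin 2) k, β'.f i X' = (η ᵥ* X') ⬝ᵥ ξ i := by
    intro i hi X'
    rw [hf', hf i hi, vecMul_transpose_dotProduct]
  have hφ' : ∀ i, i ∉ R → (η ᵥ* β'.w i) ⬝ᵥ φ = 0 := fun i hi => by rw [hw]; exact hφ i hi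
  have h := x_pairing_of_rowForms β' hκ' R ξ hfβ' φ hφ' x Y'
  rw [h]
  refine Finset.sum_congr rfl fun i _ => ?_
  rw [hw, hg]

/-- **Pinned OUTPUT** (pattern `{s; d, d, …}` of the row factors): with the hypotheses of
`x_pairing_of_colForms`, `t₁ ∈ R`, `x₀ ⊥ ξ_i` for `i ∈ R ∖ t₁` and `x₀ · ξ_{t₁} = 1`:
`(ηᵀ G_{t₁} φ) · W_{t₁} = x₀ φᵀ` — the output of `t₁` is the rank-one matrix `x₀ φᵀ` up to a scalar. -/
theorem pinned_output (β : BilinComp (mulBilin k 2 m n) ι) {η : Fin m → k} {κ' : Fin m}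
    (hκ' : η κ' ≠ 0) (R : Finset ι) (ξ : ι → Fin 2 → k)
    (hf : ∀ i ∈ R, ∀ X : Matrix (Fin 2) (Fin m) k, β.f i X = (ξ i ᵥ* X) ⬝ᵥ η)
    (φ : Fin n → k)
    (hφ : ∀ i, i ∉ R → (η ᵥ* Matrix.of fun μ ν => β.g i (Matrix.single μ ν (1 : k))) ⬝ᵥ φ = 0)
    {t₁ : ι} (ht₁ : t₁ ∈ R) (x₀ : Fin 2 → k) (hx₀ : ∀ i ∈ R, i ≠ t₁ → x₀ ⬝ᵥ ξ i = 0)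
    (h1 : x₀ ⬝ᵥ ξ t₁ = 1) :
    ((η ᵥ* Matrix.of fun μ ν => β.g t₁ (Matrix.single μ ν (1 : k))) ⬝ᵥ φ) • β.w t₁
      = vecMulVec x₀ φ := by
  obtain ⟨β', hf', hg, hw⟩ := exists_transposeDual' β
  have hfβ' : ∀ i ∈ R, ∀ X' : Matrix (Fin m) (Fin 2) k, β'.f i X' = (η ᵥ* X') ⬝ᵥ ξ i := by
    intro i hi X'
    rw [hf', hf i hi, vecMul_transpose_dotProduct]
  have hφ' : ∀ i, i ∉ R → (η ᵥ* β'.w i) ⬝ᵥ φ = 0 := fun i hi => by rw [hw]; exact hφ i hi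
  ext a b
  have h := pinned_form β' hκ' R ξ hfβ' φ hφ' ht₁ x₀ hx₀ h1
    (vecMulVec (Pi.single a (1 : k)) (Pi.single b (1 : k)))
  rw [hw, hg, sum_sum_mul_vecMulVec, single_dotProduct, Matrix.dotProduct_mulVec, vecMul_vecMulVec,
    smul_dotProduct, dotProduct_single, single_dotProduct, smul_eq_mul] at h
  have hWab : (β.w t₁ *ᵥ Pi.single b (1 : k)) a = β.w t₁ a b := by
    change (β.w t₁ a) ⬝ᵥ Pi.single b (1 : k) = β.w t₁ a b
    rw [dotProduct_single, mul_one]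
  rw [hWab, one_mul, mul_one, one_mul] at h
  rw [Matrix.smul_apply, smul_eq_mul, vecMulVec_apply]
  exact h

/-- The pinned output's coefficient is nonzero when `φ ≠ 0` (so `W_{t₁} = (ηᵀG_{t₁}φ)⁻¹ · x₀φᵀ`). -/
theorem pinned_output_coeff_ne_zero (β : BilinComp (mulBilin k 2 m n) ι) {η : Fin m → k} {κ' : Fin m}
    (hκ' : η κ' ≠ 0) (R : Finset ι) (ξ : ι → Fin 2 → k)
    (hf : ∀ i ∈ R, ∀ X : Matrix (Fin 2) (Fin m) k, β.f i X = (ξ i ᵥ* X) ⬝ᵥ η)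
    {φ : Fin n → k} (hφ0 : φ ≠ 0)
    (hφ : ∀ i, i ∉ R → (η ᵥ* Matrix.of fun μ ν => β.g i (Matrix.single μ ν (1 : k))) ⬝ᵥ φ = 0)
    {t₁ : ι} (ht₁ : t₁ ∈ R) (x₀ : Fin 2 → k) (hx₀ : ∀ i ∈ R, i ≠ t₁ → x₀ ⬝ᵥ ξ i = 0)
    (h1 : x₀ ⬝ᵥ ξ t₁ = 1) :
    (η ᵥ* Matrix.of fun μ ν => β.g t₁ (Matrix.single μ ν (1 : k))) ⬝ᵥ φ ≠ 0 := by
  obtain ⟨β', hf', hg, hw⟩ := exists_transposeDual' β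
  have hfβ' : ∀ i ∈ R, ∀ X' : Matrix (Fin m) (Fin 2) k, β'.f i X' = (η ᵥ* X') ⬝ᵥ ξ i := by
    intro i hi X'
    rw [hf', hf i hi, vecMul_transpose_dotProduct]
  have hφ' : ∀ i, i ∉ R → (η ᵥ* β'.w i) ⬝ᵥ φ = 0 := fun i hi => by rw [hw]; exact hφ i hi
  have h := pinned_coeff_ne_zero β' hκ' R ξ hfβ' hφ0 hφ' ht₁ x₀ hx₀ h1
  rwa [hw] at h

end Summit.MatrixMultiplication.OmegaCensus.RankOnePlaneCapGeneral
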